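import Literature.NumberTheory.Automorphic.BorelTorusUnipotent
import Literature.NumberTheory.Automorphic.WhittakerTowerExpansion
import Literature.MeasureTheory.Group.SubgroupAverageExchange
import Literature.MeasureTheory.Group.CoveringWeightsBochner
import HarnessLib

/-!
# Trading a cusp form for its Whittaker function inside an unfolded integral:
`∫_G H(g) Φ'(g) β(g) dg = ∫_G H(g) W̄'(g) β(g) dg` for `(N, ψ)`-equivariant `H`
(Cogdell (2004), §2.2–2.3: "integrate first over `N(K)\N(𝔸)`")

Topic `NumberTheory/Automorphic`; namespace `Literature.NumberTheory.Automorphic`. Proof file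
(theorems only), a brick of the inline decomposition of
`MoeglinWaldspurger1989_partialPairL_entire_of_rank_ne` along the road of
Jacquet–Piatetski-Shapiro–Shalika (Cogdell (2004), Thm. 2.1). The second step of the unfolding of a
Rankin–Selberg integral on `GL_n`: once the integral lives on the group against an
`N_n(K)`-covering weight `β` (`Σ_{υ ∈ N_n(K)} β(υ g) = 1`) and one factor `H` of the integrand is
`(N_n(𝔸_K), ψ)`-equivariant (`H(u g) = ψ_N(u) H(g)` — a Whittaker function in the first variable),
the other automorphic factor `Φ'` may be replaced by its `ψ⁻¹`-Whittaker function: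

  `∫_G H(g) Φ'(g) β(g) dν(g) = ∫_G H(g) conj (W_{Φ̄'}(g)) β(g) dν(g)`

(`integral_mul_mul_toReal_eq_integral_mul_conj_whittakerDepth`, **main**), where
`W_φ = whittakerDepth 0 φ` is the tree's global `ψ`-Whittaker function (Tate's character
`ψ = adeleAddChar K`, `WhittakerTower*`), so that `conj (W_{Φ̄'}(g)) = ∫_{N(K)\N(𝔸)} Φ'(u g) ψ_N(u) du`
(normalised) is the `ψ⁻¹`-Whittaker function of `Φ'`. Ingredients:

* `unipotentCharFrom_one_coe_mul`, `unipotentCharFrom_one_coe_rationalColRange`,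
  `continuous_unipotentCharFrom_one_coe` — the generic character `ψ_N` on
  `N_n(𝔸_K) = U_{[1,n-1]}(𝔸_K)` is a continuous homomorphism trivial on `N_n(K)`;
* `coveringSum_rationalColRange_weight_eq_one` — an `N_n(K)`-covering weight on `G` restricts
  along `u ↦ u x` to an `N_n(K)`-covering weight on `N_n(𝔸_K)` (`tsum_ratPoints_tail_eq`);
  `coveringSum_rationalColRange_indicator_box_eq_one` — so is the indicator of Tate's box
  (`existsUnique_smul_mem_colRangeTateDomain`);
* `integral_toReal_weight_mul_eq_setIntegral_box` — hence, for `N_n(K)`-invariant `F` on `N_n(𝔸_K)`,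
  `∫_{N(𝔸)} β(u x) F(u) du = ∫_{box} F(u) du` (`integral_wt_smul_eq_of_coveringSum_eq_one`,
  `CoveringWeightsBochner`);
* `lintegral_weight_inv_mul_eq` — `∫_{N(𝔸)} β(u⁻¹ y) du = μ(box)` (`lintegral_weight_colRange_one_eq`
  and unimodularity of `N_n(𝔸_K)`);
* `setIntegral_box_mul_unipotentCharFrom_eq` —
  `∫_{box} Φ'(u x) ψ_N(u) du = μ(box) · conj (W_{Φ̄'}(x))` (`whittakerIter_eq_boxIntegral`);
* the main theorem: the subgroup-average exchange identity
  (`integral_toReal_mul_integral_subgroup_smul_eq`, `SubgroupAverageExchange`) for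
  `U = N_n(𝔸_K) ≤ GL_n(𝔸_K)`, the weight `β` and `Ψ = H Φ' β`, followed by the three items above.

Measurable structures: an abstract Borel structure on `GL_n(𝔸_K)` (as in the `WhittakerTower*`
files), the subtype structure on `N_n(𝔸_K) = adelicColRange n K 1 (n-1)`, `μ = Measure.haar` on it.

## References

* J. W. Cogdell, *Analytic theory of L-functions for GL_n*, in *An Introduction to the Langlands
  Program* (2004), §2.2 (PDF pp. 181–184), §2.3 [CogdellAnalyticTheory2004].
* H. Jacquet, I. I. Piatetski-Shapiro, J. Shalika, *Rankin–Selberg convolutions*, Amer. J. Math.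
  105 (1983), §2.
-/

noncomputable section

open MeasureTheory Measure NumberField IsDedekindDomain Matrix Set Filter Topology
open Literature.MeasureTheory.Group
open scoped MatrixGroups ENNReal NNReal ComplexConjugate

namespace Literature.NumberTheory.Automorphic

section Exchange

variable {n : ℕ} {K : Type} [Field K] [NumberField K]
variable [MeasurableSpace (GL (Fin n) (AdeleRing (𝓞 K) K))] [BorelSpace (GL (Fin n) (AdeleRing (𝓞 K) K))]

local notation "𝔸" => AdeleRing (𝓞 K) K
local notation "Uₙ" => adelicColRange n K 1 (n - 1)
local notation "Γₙ" => rationalColRange n K 1 (n - 1)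
local notation "boxₙ" => colRangeTateDomain n K 1 (n - 1)

/-! ### The generic character on `N_n(𝔸_K) = U_{[1,n-1]}(𝔸_K)` -/

omit [MeasurableSpace (GL (Fin n) 𝔸)] [BorelSpace (GL (Fin n) 𝔸)] in
/-- `ψ_{≥1}(u) = ψ_N(u)` (`whittakerCharFun` of `WhittakerModels` transported along
`colRangeEquivUnipotent`). [folklore] -/
theorem unipotentCharFrom_one_coe_eq_whittakerCharFun (u : ↥Uₙ) :
    (unipotentCharFrom (K := K) 1 (u : GL (Fin n) 𝔸) : ℂ) =
      whittakerCharFun (adeleAddChar K) (colRangeEquivUnipotent (n := n) (K := K) u) := by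
  rw [whittakerCharFun_apply, superdiagSum_eq_superdiagSumFrom_one, unipotentCharFrom_apply]
  rfl

omit [MeasurableSpace (GL (Fin n) 𝔸)] [BorelSpace (GL (Fin n) 𝔸)] in
/-- **`ψ_N` is multiplicative on `N_n(𝔸_K)`.** [folklore] -/
theorem unipotentCharFrom_one_coe_mul (u v : ↥Uₙ) :
    (unipotentCharFrom (K := K) 1 (((u * v : ↥Uₙ)) : GL (Fin n) 𝔸) : ℂ) =
      (unipotentCharFrom (K := K) 1 (u : GL (Fin n) 𝔸) : ℂ) * (unipotentCharFrom (K := K) 1 (v : GL (Fin n) 𝔸) : ℂ) := by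
  rw [unipotentCharFrom_one_coe_eq_whittakerCharFun, unipotentCharFrom_one_coe_eq_whittakerCharFun,
    unipotentCharFrom_one_coe_eq_whittakerCharFun, map_mul, whittakerCharFun_mul]

omit [MeasurableSpace (GL (Fin n) 𝔸)] [BorelSpace (GL (Fin n) 𝔸)] in
/-- **`ψ_N` is trivial on `N_n(K)`** (Tate's character is trivial on `K`). [folklore] -/
theorem unipotentCharFrom_one_coe_rationalColRange (υ : ↥Γₙ) :
    (unipotentCharFrom (K := K) 1 (((υ : ↥Uₙ)) : GL (Fin n) 𝔸) : ℂ) = 1 := by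
  obtain ⟨γ, hγ⟩ := (mem_rationalColRange_iff (υ : ↥Uₙ)).1 υ.2
  rw [← hγ]
  change (unipotentCharFrom (K := K) 1 (ratGL K γ) : ℂ) = 1
  rw [unipotentCharFrom_ratGL, Circle.coe_one]

omit [MeasurableSpace (GL (Fin n) 𝔸)] [BorelSpace (GL (Fin n) 𝔸)] in
/-- `ψ_N` is continuous on `N_n(𝔸_K)`. [folklore] -/
theorem continuous_unipotentCharFrom_one_coe :
    Continuous fun u : ↥Uₙ => (unipotentCharFrom (K := K) 1 (u : GL (Fin n) 𝔸) : ℂ) := by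
  have hval : Continuous fun u : ↥Uₙ => ((u : GL (Fin n) 𝔸) : Matrix (Fin n) (Fin n) 𝔸) :=
    Units.continuous_val.comp continuous_subtype_val
  have hsum : Continuous fun u : ↥Uₙ => superdiagSumFrom 1 ((u : GL (Fin n) 𝔸) : Matrix (Fin n) (Fin n) 𝔸) := by
    unfold superdiagSumFrom
    refine continuous_finsetSum _ fun j _ => ?_
    split_ifs
    · exact hval.matrix_elem _ _
    · exact continuous_const
  simp only [unipotentCharFrom_apply]
  exact continuous_subtype_val.comp ((continuous_adeleAddChar (K := K)).comp hsum)

/-! ### Covering weights along `N_n(𝔸_K) x` -/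

omit [MeasurableSpace (GL (Fin n) 𝔸)] [BorelSpace (GL (Fin n) 𝔸)] in
/-- The corner group `(Q_0 ⊓ GL_1)(K)` is trivial. [folklore] -/
theorem coe_eq_one_of_mem_ratPoints_tail_zero_inf_corner_one
    (k : ↥(ratPoints (tailUnipotent n K 0 ⊓ cornerGL n K 1))) : (k : GL (Fin n) 𝔸) = 1 := by
  obtain ⟨k₀, hk₀, hk₀e⟩ := (mem_ratPoints_iff _ _).1 k.2
  have hk1 : k₀ = 1 := by
    refine Units.ext (Matrix.ext fun i j => ?_)
    rcases le_or_gt j i with hji | hij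
    · rw [mem_tailUnipotent_iff.1 (Subgroup.mem_inf.1 hk₀).1 i j (Nat.zero_le _) hji, Units.val_one, Matrix.one_apply]
    · rw [(Subgroup.mem_inf.1 hk₀).2 i j (Or.inr (by have := Fin.lt_def.1 hij; omega)), Units.val_one,
        Matrix.one_apply]
  rw [← hk₀e, hk1, map_one]

omit [MeasurableSpace (GL (Fin n) 𝔸)] [BorelSpace (GL (Fin n) 𝔸)] in
/-- **An `N_n(K)`-covering weight on `G` restricts to one on `N_n(𝔸_K)`**: for `β` with
`Σ_{q ∈ N_n(K)} β(q y) = 1` for all `y` and every `x`, the function `u ↦ β(u x)` on `N_n(𝔸_K)` has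
covering sums `Σ_{υ ∈ N_n(K)} β(υ u x) = 1` (`tsum_ratPoints_tail_eq` at `e = 0`, `c = 1`, the
corner group being trivial). [folklore] -/
theorem coveringSum_rationalColRange_weight_eq_one (hn : 0 < n) {β : GL (Fin n) 𝔸 → ℝ≥0∞}
    (hβ : ∀ y, coveringSum ↥(ratPoints (tailUnipotent n K 0)) β y = 1) (x : GL (Fin n) 𝔸) (u : ↥Uₙ) :
    coveringSum ↥Γₙ (fun v : ↥Uₙ => β ((v : GL (Fin n) 𝔸) * x)) u = 1 := by
  have h := hβ ((u : GL (Fin n) 𝔸) * x)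
  rw [coveringSum_apply] at h ⊢
  simp only [Subgroup.smul_def, smul_eq_mul] at h
  rw [tsum_ratPoints_tail_eq (Nat.zero_le 1) hn hn (fun g => β (g * ((u : GL (Fin n) 𝔸) * x)))] at h
  haveI : Subsingleton ↥(ratPoints (tailUnipotent n K 0 ⊓ cornerGL n K 1)) :=
    ⟨fun k k' => Subtype.ext ((coe_eq_one_of_mem_ratPoints_tail_zero_inf_corner_one k).trans
      (coe_eq_one_of_mem_ratPoints_tail_zero_inf_corner_one k').symm)⟩
  rw [tsum_eq_single (1 : ↥(ratPoints (tailUnipotent n K 0 ⊓ cornerGL n K 1)))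
    (fun k hk => absurd (Subsingleton.elim k 1) hk)] at h
  simp only [Subgroup.coe_one, one_mul] at h
  rw [← h]
  refine tsum_congr fun υ => ?_
  rw [Subgroup.smul_def, smul_eq_mul, Subgroup.coe_mul, mul_assoc]

omit [MeasurableSpace (GL (Fin n) 𝔸)] [BorelSpace (GL (Fin n) 𝔸)] in
/-- **The indicator of Tate's box is an `N_n(K)`-covering weight on `N_n(𝔸_K)`**: every `u` has exactly
one `N_n(K)`-translate in the box (`existsUnique_smul_mem_colRangeTateDomain`). [folklore] -/
theorem coveringSum_rationalColRange_indicator_box_eq_one (u : ↥Uₙ) :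
    coveringSum ↥Γₙ ((boxₙ).indicator fun _ => (1 : ℝ≥0∞)) u = 1 := by
  classical
  obtain ⟨γ₀, hγ₀, huniq⟩ := existsUnique_smul_mem_colRangeTateDomain (n := n) (K := K) (a := 1) (b := n - 1) u
  rw [coveringSum_apply, tsum_eq_single γ₀]
  · rw [Set.indicator_of_mem hγ₀]
  · intro γ hγ
    rw [Set.indicator_of_notMem]
    exact fun hmem => hγ (huniq γ hmem)

/-! ### The covering-weight swap on `N_n(𝔸_K)` and the box integral -/

/-- **`∫_{N(𝔸)} β(u x) F(u) du = ∫_{box} F(u) du`** for an `N_n(K)`-invariant Borel `F : N_n(𝔸_K) → ℂ` with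
`∫ ‖F(u)‖ β(u x) du < ∞`, an `N_n(K)`-covering weight `β` on `G` and a Haar measure on `N_n(𝔸_K)`
(independence of the weight, `integral_wt_smul_eq_of_coveringSum_eq_one`, between the weights
`u ↦ β(u x)` and `1_{box}`). [folklore] -/
theorem integral_toReal_weight_mul_eq_setIntegral_box (hn : 0 < n) (μ : Measure ↥Uₙ) [IsHaarMeasure μ]
    {F : ↥Uₙ → ℂ} (hFm : Measurable F) (hFinv : ∀ (υ : ↥Γₙ) (u : ↥Uₙ), F (υ • u) = F u)
    {β : GL (Fin n) 𝔸 → ℝ≥0∞} (hβm : Measurable β)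
    (hβ : ∀ y, coveringSum ↥(ratPoints (tailUnipotent n K 0)) β y = 1) (x : GL (Fin n) 𝔸)
    (hint : ∫⁻ u, ‖F u‖ₑ * β ((u : GL (Fin n) 𝔸) * x) ∂μ < ∞) :
    ∫ u, ((β ((u : GL (Fin n) 𝔸) * x)).toReal : ℂ) * F u ∂μ = ∫ u in boxₙ, F u ∂μ := by
  classical
  have hβ₁m : Measurable fun v : ↥Uₙ => β ((v : GL (Fin n) 𝔸) * x) :=
    hβm.comp ((continuous_subtype_val.mul continuous_const).measurable)
  have hβ₂m : Measurable ((boxₙ).indicator fun _ : ↥Uₙ => (1 : ℝ≥0∞)) :=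
    measurable_const.indicator measurableSet_colRangeTateDomain
  have key := integral_wt_smul_eq_of_coveringSum_eq_one μ hFm.stronglyMeasurable hFinv hβ₁m hβ₂m
    (coveringSum_rationalColRange_weight_eq_one hn hβ x) coveringSum_rationalColRange_indicator_box_eq_one hint
  have h1 : ∀ u : ↥Uₙ, wt (fun v : ↥Uₙ => β ((v : GL (Fin n) 𝔸) * x)) u • F u =
      ((β ((u : GL (Fin n) 𝔸) * x)).toReal : ℂ) * F u := fun u => by
    rw [wt, Complex.real_smul]
  have h2 : ∀ u : ↥Uₙ, wt ((boxₙ).indicator fun _ : ↥Uₙ => (1 : ℝ≥0∞)) u • F u = (boxₙ).indicator F u := by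
    intro u
    by_cases hu : u ∈ boxₙ
    · rw [wt, Set.indicator_of_mem hu, Set.indicator_of_mem hu, ENNReal.toReal_one, one_smul]
    · rw [wt, Set.indicator_of_notMem hu, Set.indicator_of_notMem hu, ENNReal.toReal_zero, zero_smul]
  simp_rw [h1, h2] at key
  rw [key, integral_indicator measurableSet_colRangeTateDomain]

/-- **`∫_{N(𝔸)} β(u⁻¹ y) du = μ(box)`** for an `N_n(K)`-covering weight `β` and `μ = Measure.haar` on
`N_n(𝔸_K)` (`lintegral_weight_colRange_one_eq` and the inversion invariance of the Haar measures of
the unimodular group `N_n(𝔸_K)`). [folklore] -/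
theorem lintegral_weight_inv_mul_eq (hn : 0 < n) {β : GL (Fin n) 𝔸 → ℝ≥0∞} (hβm : Measurable β)
    (hβ : ∀ y, coveringSum ↥(ratPoints (tailUnipotent n K 0)) β y = 1) (y : GL (Fin n) 𝔸) :
    ∫⁻ u : ↥Uₙ, β (((u : GL (Fin n) 𝔸))⁻¹ * y) ∂(Measure.haar (G := ↥Uₙ)) =
      (Measure.haar (G := ↥Uₙ)) boxₙ := by
  have hmeas : Measurable fun u : ↥Uₙ => β ((u : GL (Fin n) 𝔸) * y) :=
    hβm.comp ((continuous_subtype_val.mul continuous_const).measurable)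
  rw [← lintegral_weight_colRange_one_eq hn hβm hβ y,
    ← lintegral_inv_eq_of_isHaarMeasure_adelicColRange (Measure.haar (G := ↥Uₙ)) hmeas]
  refine lintegral_congr fun u => ?_
  rw [Subgroup.coe_inv]

/-- **The box integral against `ψ_N` is the conjugate Whittaker function**: for continuous `Φ'` and a
Haar measure `μ` on `N_n(𝔸_K)`,
`∫_{box} Φ'(u x) ψ_N(u) dμ(u) = μ(box) · conj (W_{Φ̄'}(x))`, `W_φ = whittakerDepth 0 φ`
(`whittakerIter_eq_boxIntegral` for `φ = conj ∘ Φ'`, and `conj ∫ = ∫ conj`). [folklore] -/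
theorem setIntegral_box_mul_unipotentCharFrom_eq (hn : 0 < n) (μ : Measure ↥Uₙ) [IsHaarMeasure μ]
    {Φ' : GL (Fin n) 𝔸 → ℂ} (hΦ'c : Continuous Φ') (x : GL (Fin n) 𝔸) :
    ∫ u in boxₙ, Φ' ((u : GL (Fin n) 𝔸) * x) * (unipotentCharFrom (K := K) 1 (u : GL (Fin n) 𝔸) : ℂ) ∂μ =
      ((μ boxₙ).toReal : ℂ) * conj (whittakerDepth 0 (fun g => conj (Φ' g)) x) := by
  have hk : n - (n - 1) = 1 := by omega
  have hcont : Continuous fun g => conj (Φ' g) := Complex.continuous_conj.comp hΦ'c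
  have hclosed := whittakerIter_eq_boxIntegral (K := K) hcont (n - 1) (by omega)
  rw [hk] at hclosed
  have h1 := hclosed μ x
  have hW : whittakerDepth 0 (fun g => conj (Φ' g)) x = whittakerIter (n - 1) (fun g => conj (Φ' g)) x := rfl
  have hvol0 : (μ boxₙ).toReal ≠ 0 :=
    ENNReal.toReal_ne_zero.2 ⟨(measure_colRangeTateDomain_pos_of_isHaarMeasure μ).ne',
      (measure_colRangeTateDomain_lt_top μ).ne⟩
  rw [hW, h1, Complex.real_smul, map_mul, Complex.conj_ofReal, ← integral_conj]
  simp only [map_mul, Complex.conj_conj]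
  rw [← mul_assoc, Complex.ofReal_inv, mul_inv_cancel₀ (Complex.ofReal_ne_zero.2 hvol0), one_mul]

/-! ### The exchange -/

/-- **Trading `Φ'` for its `ψ⁻¹`-Whittaker function** (Cogdell (2004), §2.2, the passage from
`∫_{N_m(K)\GL_m(𝔸)}` to `∫_{N_m(𝔸)\GL_m(𝔸)}`: "integrate first over `N(K)\N(𝔸)`"). Let `0 < n`, `ν` a Haar
measure on `G = GL_n(𝔸_K)`, `H : G → ℂ` Borel and `(N_n(𝔸_K), ψ)`-equivariant
(`H(u x) = ψ_N(u) H(x)`), `Φ' : G → ℂ` continuous, bounded and left `N_n(K)`-invariant, and `β` a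
Borel `N_n(K)`-covering weight on `G`. If `H Φ' β` is `ν`-integrable then

  `∫_G H(x) Φ'(x) β(x) dν(x) = ∫_G H(x) conj (W_{Φ̄'}(x)) β(x) dν(x)`,

`W_φ = whittakerDepth 0 φ` the global `ψ`-Whittaker function (so `conj (W_{Φ̄'})` is the
`ψ⁻¹`-Whittaker function of `Φ'`). Proof: the subgroup-average exchange identity for
`U = N_n(𝔸_K)` and the weight `β` (`integral_toReal_mul_integral_subgroup_smul_eq`), the
covering-weight swap on `N_n(𝔸_K)` (`integral_toReal_weight_mul_eq_setIntegral_box`) and the box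
formula (`setIntegral_box_mul_unipotentCharFrom_eq`); the box volumes cancel.
[cite: CogdellAnalyticTheory2004, §2.2 (PDF pp. 181–182)] -/
theorem integral_mul_mul_toReal_eq_integral_mul_conj_whittakerDepth (hn : 0 < n)
    (ν : Measure (GL (Fin n) 𝔸)) [IsHaarMeasure ν]
    {H : GL (Fin n) 𝔸 → ℂ} (hHm : Measurable H)
    (hH : ∀ (u : ↥Uₙ) (x : GL (Fin n) 𝔸),
      H ((u : GL (Fin n) 𝔸) * x) = (unipotentCharFrom (K := K) 1 (u : GL (Fin n) 𝔸) : ℂ) * H x)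
    {Φ' : GL (Fin n) 𝔸 → ℂ} (hΦ'c : Continuous Φ') {M : ℝ} (hΦ'b : ∀ g, ‖Φ' g‖ ≤ M)
    (hΦ'N : ∀ (υ : ↥Γₙ) (x : GL (Fin n) 𝔸), Φ' ((((υ : ↥Uₙ)) : GL (Fin n) 𝔸) * x) = Φ' x)
    {β : GL (Fin n) 𝔸 → ℝ≥0∞} (hβm : Measurable β)
    (hβ : ∀ y, coveringSum ↥(ratPoints (tailUnipotent n K 0)) β y = 1)
    (hint : Integrable (fun x => H x * Φ' x * ((β x).toReal : ℂ)) ν) :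
    ∫ x, H x * Φ' x * ((β x).toReal : ℂ) ∂ν =
      ∫ x, H x * conj (whittakerDepth 0 (fun g => conj (Φ' g)) x) * ((β x).toReal : ℂ) ∂ν := by
  -- instances (as in `BorelTorusUnipotent`)
  haveI : T2Space (GL (Fin n) 𝔸) := t2Space_gl n K
  haveI : SecondCountableTopology (GL (Fin n) 𝔸) := secondCountableTopology_generalLinearGroup_adeleRing K (Fin n)
  haveI : LocallyCompactSpace (GL (Fin n) 𝔸) := AdelicGroupData.locallyCompactSpace_generalLinearGroup_adeleRing K (Fin n)
  haveI : SecondCountableTopology ↥Uₙ := TopologicalSpace.Subtype.secondCountableTopology _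
  haveI : LocallyCompactSpace ↥Uₙ :=
    (isClosed_adelicColRange (n := n) (K := K) (a := 1) (b := n - 1)).locallyCompactSpace
  haveI : MeasurableMul₂ (GL (Fin n) 𝔸) := inferInstance
  haveI : MeasurableInv (GL (Fin n) 𝔸) := inferInstance
  haveI : SigmaFinite ν := inferInstance
  set μU : Measure ↥Uₙ := Measure.haar with hμU
  set V : ℝ≥0∞ := μU boxₙ with hV
  have hV0 : V ≠ 0 := (measure_colRangeTateDomain_pos_of_isHaarMeasure μU).ne'
  have hVtop : V ≠ ∞ := (measure_colRangeTateDomain_lt_top μU).ne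
  have hVr0 : V.toReal ≠ 0 := ENNReal.toReal_ne_zero.2 ⟨hV0, hVtop⟩
  -- the character
  set χ : ↥Uₙ → ℂ := fun u => (unipotentCharFrom (K := K) 1 (u : GL (Fin n) 𝔸) : ℂ) with hχ
  have hχc : Continuous χ := continuous_unipotentCharFrom_one_coe
  have hχ1 : ∀ u, ‖χ u‖ = 1 := fun u => Circle.norm_coe _
  -- the integrand
  set Ψ : GL (Fin n) 𝔸 → ℂ := fun x => H x * Φ' x * ((β x).toReal : ℂ) with hΨ
  have hΨm : Measurable Ψ :=
    (hHm.mul hΦ'c.measurable).mul (Complex.measurable_ofReal.comp hβm.ennreal_toReal)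
  -- the exchange identity
  have hex := integral_toReal_mul_integral_subgroup_smul_eq (Uₙ) μU ν hβm hVtop
    (fun y => lintegral_weight_inv_mul_eq hn hβm hβ y) hΨm hint
  -- the inner integral
  have hM0 : 0 ≤ M := le_trans (norm_nonneg _) (hΦ'b 1)
  have hinner : ∀ x : GL (Fin n) 𝔸, ∫ u : ↥Uₙ, Ψ ((u : GL (Fin n) 𝔸) • x) ∂μU =
      H x * (((V.toReal : ℂ)) * conj (whittakerDepth 0 (fun g => conj (Φ' g)) x)) := by
    intro x
    set F : ↥Uₙ → ℂ := fun u => Φ' ((u : GL (Fin n) 𝔸) * x) * χ u with hF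
    have hFm : Measurable F :=
      ((hΦ'c.comp (continuous_subtype_val.mul continuous_const)).mul hχc).measurable
    have hFinv : ∀ (υ : ↥Γₙ) (u : ↥Uₙ), F (υ • u) = F u := by
      intro υ u
      simp only [hF, hχ, Subgroup.smul_def, smul_eq_mul, Subgroup.coe_mul, mul_assoc]
      rw [hΦ'N υ]
      congr 1
      have h := unipotentCharFrom_one_coe_mul (n := n) (K := K) (υ : ↥Uₙ) u
      rw [Subgroup.coe_mul] at h
      rw [h, unipotentCharFrom_one_coe_rationalColRange, one_mul]
    have h1 : ∀ u : ↥Uₙ, Ψ ((u : GL (Fin n) 𝔸) • x) =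
        H x * (((β ((u : GL (Fin n) 𝔸) * x)).toReal : ℂ) * F u) := by
      intro u
      simp only [hΨ, hF, hχ, smul_eq_mul, hH]
      ring
    simp_rw [h1]
    rw [integral_const_mul]
    congr 1
    -- the covering-weight swap on `N(𝔸)` and the box formula
    have hint' : ∫⁻ u, ‖F u‖ₑ * β ((u : GL (Fin n) 𝔸) * x) ∂μU < ∞ := by
      have hb : ∀ u, ‖F u‖ₑ * β ((u : GL (Fin n) 𝔸) * x) ≤ ENNReal.ofReal M * β ((u : GL (Fin n) 𝔸) * x) := by
        intro u
        refine mul_le_mul_left ?_ _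
        rw [← ofReal_norm]
        refine ENNReal.ofReal_le_ofReal ?_
        rw [hF]
        simp only [norm_mul, hχ1, mul_one]
        exact hΦ'b _
      have hmeas : Measurable fun u : ↥Uₙ => β ((u : GL (Fin n) 𝔸) * x) :=
        hβm.comp ((continuous_subtype_val.mul continuous_const).measurable)
      calc ∫⁻ u, ‖F u‖ₑ * β ((u : GL (Fin n) 𝔸) * x) ∂μU
          ≤ ∫⁻ u, ENNReal.ofReal M * β ((u : GL (Fin n) 𝔸) * x) ∂μU := lintegral_mono hb
        _ = ENNReal.ofReal M * ∫⁻ u, β ((u : GL (Fin n) 𝔸) * x) ∂μU := lintegral_const_mul _ hmeas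
        _ = ENNReal.ofReal M * V := by rw [hμU, lintegral_weight_colRange_one_eq hn hβm hβ x]
        _ < ∞ := ENNReal.mul_lt_top ENNReal.ofReal_lt_top hVtop.lt_top
    rw [integral_toReal_weight_mul_eq_setIntegral_box hn μU hFm hFinv hβm hβ x hint',
      setIntegral_box_mul_unipotentCharFrom_eq hn μU hΦ'c x]
  simp_rw [hinner] at hex
  -- cancel the box volume
  have hlhs : ∫ x, ((β x).toReal : ℂ) * (H x * ((V.toReal : ℂ) * conj (whittakerDepth 0 (fun g => conj (Φ' g)) x))) ∂ν =
      (V.toReal : ℂ) * ∫ x, H x * conj (whittakerDepth 0 (fun g => conj (Φ' g)) x) * ((β x).toReal : ℂ) ∂ν := by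
    rw [← integral_const_mul]
    refine integral_congr_ae (Eventually.of_forall fun x => ?_)
    ring
  rw [hlhs] at hex
  exact (mul_left_cancel₀ (Complex.ofReal_ne_zero.2 hVr0) hex).symm

end Exchange

end Literature.NumberTheory.Automorphic
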